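import Summits.QuantumFields.BalabanUV.Beta.FP.StepLawInherit
import Literature.MathematicalPhysics.QuantumFieldTheory.Balaban1983to89.Beta.ScalewiseWitness

/-!
# `BalabanUV.Beta.FP.StepLawFeed` — road «FP» for binder row D1, ROUTE T, memo `N2B-DESIGN.md` §30 (30g) ∕ SPEC-30g: **THE READ-OUT FEED — from the
# (STEP) door's LATTICE KERNEL LAW at every `(j, m)` to the END's N2 binders, LAST-STEP-OUT, through leaf-01 g4's `StepLawInherit` sockets**

WHY (30g).  The END of record (`RoadExplicitDefect.d1Drift_JsBalT2Of_pinned_explicitDefect`) consumes `hSDF : secondMoment (defect TP RP m) μ ν = 0` for the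
explicit fixed-point defect; `StepLawInherit.n2Binders_of_stepLaw` reduces the whole N2 triple to the STEP LAW OF THE PERFECT READ-OUTS
`secondMoment (TP (m+1)) = secondMoment (TP m) + secondMoment (TP 1)`, and `StepLawInherit.stepLaw_of_levelwise` inherits that law from the finite levels
LAST-STEP-OUT: `Sr j (m+1) = Sr j m + Sr (j+m) 1 + e j m`, `e j m → 0`, `Sr j m → F m`.  LAST-STEP-OUT is exactly the road door's peel (the coarse system of
`NestedStepLawTorusCompositeOneShot(Top)` is the TOP step at level `j+m`, its jets the words dressed DOWN through the composite's `L … I`).  After the (J-b)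
bricks (#20 `SecondVarKernelLaw`, #22 `GradedPackedHess`, #24 `KernelDoorLegCurrency`), (B2), (P2″) and #23 `KernelLawDeperiodised`, the door at `(j, m)` is an
identity of LATTICE kernels `𝒦_N^{(j,m+1)} = 𝒦_F^{(j,m)} + 𝒦_G^{(j,m)}` (one-shot `(m+1)`-fold = one-shot `m`-fold + the top step DRESSED through the composite
column).  THIS FILE is the [folklore] bookkeeping from there to `n2Binders_of_stepLaw`'s `hstep`:
* §1 `inv_of_tendsto_common` — (inv) from a COMMON LIMIT: if the dressed top term's read-out tends to `F 1` (in the instance: to `secondMoment (RP m)`, which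
  EQUALS `secondMoment (TP 1)` by an4's transport invariance at the fixed point `StepLawKHolds.hasSum_transport_m2Tensor_perfCol_holds`) and the one-step read-outs
  tend to `F 1`, then `e j m := g j m − Sr (j+m) 1 → 0` — NO finite-`j` `EntryHyps`; `inv_of_tendsto_eq` (the two limits given separately with a proof they agree);
* §2 **`stepLaw_readouts_of_kernel_law`** — kernel law at every `(j,m)` (`T j (m+1) = T j m + G j m` entrywise) + `AbsMoment₂` + (inv) + (conv) ⟹
  `∀ m ≥ 1, F (m+1) = F m + F 1` (`ScalewiseWitness.secondMoment_add` + `stepLaw_of_levelwise` BY NAME);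
* §3 **`n2Binders_of_kernel_law`** — the same composed with `n2Binders_of_stepLaw`: admissibility of the perfect `m`-step transport against `TP 1` (`hadm`),
  `AbsMoment₂ (TP m)`, the kernel law + `AbsMoment₂` + (inv) + (conv towards `secondMoment (TP m)`) ⟹ `hfub ∧ hDA ∧ hSDF` for `defect TP RP` — the END's three
  N2 binders, with `T j m` := the road's lattice kernels.
WHAT STAYS DISPLAYED (the road's rows, named in TID § F.8 ∕ (30g)): the kernel law at each `(j,m)` (STEPS 1–4), `AbsMoment₂` of the lattice kernels (decay of
`hessKer`-shaped words, `ExpKernelCalculus.decay510_hessKer`), (conv) = the (T-LIM-j) rows in `secondMoment` currency, and the dressed term's limit (the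
composite's `minOp` blocks → `colOf (KPerf m)`).  No `def`, no `def … : Prop`, nothing cited, 0 sorry; the only analysis is `tendsto_nhds_unique` inside the
cited sockets.

HONEST DEPENDENCY (page 1, mandatory): continuum YM on T⁴ ⇐ BetaPertH ∧ nine spine estimates (0/9 proved); BetaPertH ⇐ (D1) ∧ (D4) ∧ CAP+tail;
G-an2-4 gates asym, D1 and NE2/3/4.  HONEST FRAMING (cell contract, verbatim): «discharging `BetaPertH` makes Bałaban's UV stability UNCONDITIONAL —
a real constructive-QFT result; it is NOT the continuum limit and NOT the Clay problem.»  ABSOLUTE RULE (cell charter, verbatim): «No internally-minted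
statement may enter as a cited fact. Every hypothesis is either kernel-proved in this package or a verbatim quotation of a PUBLISHED theorem with page
reference. The manuscript(s) under audit are NOT citable for their own disputed steps — they are the thing under adjudication; programme-internal
(2001/route/tribunal) claims are never citable.»  [folklore] bookkeeping; nothing of Bałaban's asserted; 0 estimates; 0∕4 row-D1 binders (every row above
stays a hypothesis); NOT (T-ID), NOT SDF, NOT D1, NOT BetaPertH, NOT continuum, NOT Clay.  Road «FP» OWNER, b2b-balaban-beta-d1-p3 gen 21, 2026-08-22.
No existing file touched.
-/

noncomputable section

namespace Summit.QuantumFields.BalabanUV.Beta.FP.StepLawFeed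

open Filter Topology
open Literature.MathematicalPhysics.QuantumFieldTheory.Balaban1983to89
open Literature.MathematicalPhysics.QuantumFieldTheory.Balaban1983to89.Beta
open B12Beta (secondMoment)
open DecimatedMomentSummable (AbsMoment₂)
open DressedMomentNormalisation (EKer dressedEntry EntryHyps)
open ScalewiseWitness (secondMoment_add)
open Summit.QuantumFields.BalabanUV.Beta.FP.StepDefectInherit (defect)
open Summit.QuantumFields.BalabanUV.Beta.FP.StepLawInherit (stepLaw_of_levelwise n2Binders_of_stepLaw)

/-! ## §1 (inv) from a common limit -/

section Inv

/-- [folklore] **(inv) FROM A COMMON LIMIT**: if the dressed top term's read-outs `g j m` tend (in `j`) to `F1` for every `m ≥ 1` and the one-step read-outs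
`t j` tend to the same `F1`, then `e j m := g j m − t (j+m) → 0` (the shifted one-step sequence is a subsequence).  In the instance `F1 = secondMoment (TP 1)`
and the dressed term's limit `secondMoment (RP m)` is identified with it by an4's transport invariance at the fixed point — no finite-`j` reproduction letter. -/
theorem inv_of_tendsto_common {g : ℕ → ℕ → ℝ} {t : ℕ → ℝ} {F1 : ℝ}
    (hg : ∀ m : ℕ, 1 ≤ m → Tendsto (fun j => g j m) atTop (𝓝 F1)) (ht : Tendsto t atTop (𝓝 F1)) :
    ∀ m : ℕ, 1 ≤ m → Tendsto (fun j => g j m - t (j + m)) atTop (𝓝 0) := by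
  intro m hm
  have h := (hg m hm).sub (ht.comp (tendsto_add_atTop_nat m))
  rw [sub_self] at h
  exact h

/-- [folklore] The same with the two limits displayed separately and a proof that they agree (`hRP : gP m = F1` — the transport-invariance VALUE). -/
theorem inv_of_tendsto_eq {g : ℕ → ℕ → ℝ} {t : ℕ → ℝ} {gP : ℕ → ℝ} {F1 : ℝ}
    (hg : ∀ m : ℕ, 1 ≤ m → Tendsto (fun j => g j m) atTop (𝓝 (gP m))) (hRP : ∀ m : ℕ, 1 ≤ m → gP m = F1)
    (ht : Tendsto t atTop (𝓝 F1)) :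
    ∀ m : ℕ, 1 ≤ m → Tendsto (fun j => g j m - t (j + m)) atTop (𝓝 0) :=
  inv_of_tendsto_common (fun m hm => hRP m hm ▸ hg m hm) ht

end Inv

/-! ## §2 The read-out step law from the kernel law at every `(j, m)` -/

section Feed

variable {T G : ℕ → ℕ → EKer 4} {F : ℕ → ℝ}

/-- [folklore] **THE STEP LAW OF THE LIMIT READ-OUTS FROM THE (STEP) DOOR's LATTICE KERNEL LAW, LAST-STEP-OUT.**  Kernel families `T j m` (READING: the
lattice kernel of the `m`-fold one-shot literal at base level `j`, in the END's bond units) and `G j m` (the TOP step at level `j+m` DRESSED through the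
`m`-fold composite column — the road door's coarse words) with: (law) `T j (m+1) = T j m + G j m` entrywise for `m ≥ 1` (the door de-periodised, #23);
(abs) absolutely summable second moments; (inv) `secondMoment (G j m) − secondMoment (T (j+m) 1) → 0` (§1); (conv) `secondMoment (T j m) → F m`.  THEN
`F (m+1) = F m + F 1` for every `m ≥ 1` — `StepLawInherit.stepLaw_of_levelwise` with `Sr j m := secondMoment (T j m) μ ν`. -/
theorem stepLaw_readouts_of_kernel_law (μ ν : Fin 4)
    (hlaw : ∀ j m : ℕ, 1 ≤ m → ∀ (a b : Fin 4) (z : Fin 4 → ℤ), T j (m + 1) a b z = T j m a b z + G j m a b z)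
    (hT : ∀ j m : ℕ, 1 ≤ m → ∀ a b : Fin 4, AbsMoment₂ (T j m a b))
    (hG : ∀ j m : ℕ, 1 ≤ m → ∀ a b : Fin 4, AbsMoment₂ (G j m a b))
    (hinv : ∀ m : ℕ, 1 ≤ m → Tendsto (fun j => secondMoment (G j m) μ ν - secondMoment (T (j + m) 1) μ ν) atTop (𝓝 0))
    (hconv : ∀ m : ℕ, 1 ≤ m → Tendsto (fun j => secondMoment (T j m) μ ν) atTop (𝓝 (F m))) :
    ∀ m : ℕ, 1 ≤ m → F (m + 1) = F m + F 1 := by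
  refine stepLaw_of_levelwise (Sr := fun j m => secondMoment (T j m) μ ν)
    (e := fun j m => secondMoment (G j m) μ ν - secondMoment (T (j + m) 1) μ ν) (fun j m hm => ?_) hinv hconv
  have hsum : T j (m + 1) = T j m + G j m := by
    funext a b z
    rw [hlaw j m hm a b z]
    rfl
  simp only [hsum, secondMoment_add (hT j m hm) (hG j m hm) μ ν]
  ring

end Feed

/-! ## §3 The END's three N2 binders from the kernel law -/

section End

variable {TP w : ℕ → EKer 4} {N : ℕ → ℕ} {T G : ℕ → ℕ → EKer 4}

/-- [folklore] **THE N2 BINDERS OF THE END OF RECORD FROM THE (STEP) DOOR's LATTICE KERNEL LAW** (= `StepLawInherit.n2Binders_of_stepLaw` ∘ §2): admissibility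
of the perfect `m`-step transport against `TP 1` (`hadm` — `StepLawKHolds.entryHyps_perfCol_holds` at the record), `AbsMoment₂ (TP m)`
(`RoadExplicitDefect.absMoment₂_TPerf_record`), and the road's four rows — the kernel law at every `(j,m)`, `AbsMoment₂` of the lattice kernels, (inv), (conv)
towards `secondMoment (TP m)` — give `hfub ∧ hDA ∧ hSDF` for the explicit fixed-point defect `defect TP RP`,
`RP m = (N m)⁸·dressedEntry (w m) (TP 1) ((N m)•·)`. -/
theorem n2Binders_of_kernel_law (hadm : ∀ m : ℕ, 1 ≤ m → EntryHyps (N m) (w m) (TP 1))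
    (hA : ∀ m : ℕ, 1 ≤ m → ∀ a b : Fin 4, AbsMoment₂ (TP m a b)) (μ ν : Fin 4)
    (hlaw : ∀ j m : ℕ, 1 ≤ m → ∀ (a b : Fin 4) (z : Fin 4 → ℤ), T j (m + 1) a b z = T j m a b z + G j m a b z)
    (hT : ∀ j m : ℕ, 1 ≤ m → ∀ a b : Fin 4, AbsMoment₂ (T j m a b))
    (hG : ∀ j m : ℕ, 1 ≤ m → ∀ a b : Fin 4, AbsMoment₂ (G j m a b))
    (hinv : ∀ m : ℕ, 1 ≤ m → Tendsto (fun j => secondMoment (G j m) μ ν - secondMoment (T (j + m) 1) μ ν) atTop (𝓝 0))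
    (hconv : ∀ m : ℕ, 1 ≤ m → Tendsto (fun j => secondMoment (T j m) μ ν) atTop (𝓝 (secondMoment (TP m) μ ν))) :
    (∀ m : ℕ, 1 ≤ m → ∀ (a b : Fin 4) (z : Fin 4 → ℤ),
        TP (m + 1) a b z = ((N m : ℕ) : ℝ) ^ 8 * dressedEntry (w m) (TP 1) (((N m : ℕ) : ℤ) • z) a b + TP m a b z
          + defect TP (fun m a b z => ((N m : ℕ) : ℝ) ^ 8 * dressedEntry (w m) (TP 1) (((N m : ℕ) : ℤ) • z) a b) m a b z)
    ∧ (∀ m : ℕ, 1 ≤ m → ∀ a b : Fin 4, AbsMoment₂ (defect TP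
        (fun m a b z => ((N m : ℕ) : ℝ) ^ 8 * dressedEntry (w m) (TP 1) (((N m : ℕ) : ℤ) • z) a b) m a b))
    ∧ (∀ m : ℕ, 1 ≤ m → secondMoment (defect TP
        (fun m a b z => ((N m : ℕ) : ℝ) ^ 8 * dressedEntry (w m) (TP 1) (((N m : ℕ) : ℤ) • z) a b) m) μ ν = 0) :=
  n2Binders_of_stepLaw hadm hA μ ν
    (stepLaw_readouts_of_kernel_law (F := fun m => secondMoment (TP m) μ ν) μ ν hlaw hT hG hinv hconv)

end End

end Summit.QuantumFields.BalabanUV.Beta.FP.StepLawFeed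

end
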